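import Mathlib
import HarnessLib
import Literature.Analysis.FluidPDE.KochTataru
import Literature.Analysis.FluidPDE.KochTataruKernel
import Literature.Analysis.FluidPDE.KochTataruPointwise
import Literature.Analysis.FluidPDE.KNSSRemark61
import Literature.Analysis.FluidPDE.KNSSMildDecayHorizontal
import Literature.Analysis.FluidPDE.UlocKernelEstimates
import Summits.NavierStokesRegularity.NavierStokesRegularity.Theorems.PoloidalWindowDoorPoloidalWindowRigidityZeroModeRadial

/-!
# Route `PoloidalWindowDoor`, crux `PoloidalWindowRigidity` (stmt-NavierStokesRegularity-19708) — LINE 16 «zero_mode» (ns-idea-8 g8, v1.1), stub Z-oseen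
# `stub_zeroModeOseen`, BOX STEP: the box integral `∫_{x∈Q} K(σ, x − y)[a(y), b(y)] dx` of the Oseen kernel has `L¹_y`-size
# `≤ C₀ M² M₀ (4(|Q_in| + |Q_core|)/r + |Q ∖ Q_core| σ^{-1/2})` (three regions)

Cell ns-regularity-ideate, seat ns-poloidal-K2-p2 g13 (K2 hand).  Helper file (no stub closed here) for the L-sized stub Z-oseen of LINE 16
(`Cruxes/PoloidalWindowRigidity/Lines/zero_mode.lean` v1.1, `ZeroModeOseen`).  With the Koch–Tataru weight `k_σ(z) = (σ + ‖z‖²)^{-2}` on `E3`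
(`‖K(σ,z)[a,b]‖ ≤ C₀ k_σ(z)‖a‖‖b‖`, tree `Literature.Analysis.FluidPDE.exists_norm_oseenKernel_three_le`), `M₀ = ∫(1+‖w‖²)^{-2}`, and the two radial
integrals of `…ZeroModeRadial` (`∫ k_σ = M₀σ^{-1/2}`, `∫_{‖z‖≥r} k_σ ≤ 4M₀/r`):

* `enorm_setIntegral_oseenKernel_le_of_far` (INNER REGION): if every point of `Qᶜ` is at distance `≥ r` from `y`, then
  `‖∫_{x∈Q} K(σ,x−y)[a,b] dx‖ ≤ C₀‖a‖‖b‖·4M₀/r` — because the WHOLE-SPACE integral vanishes (`Literature.Analysis.FluidPDE.integral_oseenKernel_eq_zero`,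
  oddness of the kernel, KNSSRemark61), so the box integral equals minus the integral over `Qᶜ`, which lies in the tail `‖x − y‖ ≥ r`;
* `lintegral_enorm_setIntegral_oseenKernel_le` (THREE REGIONS): for fields `a, b` bounded by `M`, measurable sets `Q_core ⊆ Q`, `Q_in` with
  `dist(Q_in, Qᶜ) ≥ r` and `dist(Q_core, Q_inᶜ) ≥ r`,
  `∫_y ‖∫_{x∈Q} K(σ,x−y)[a(y),b(y)] dx‖ dy ≤ C₀ M² M₀ (4(V_in + V_core)/r + V_sh σ^{-1/2})` whenever `|Q_in| ≤ V_in`, `|Q_core| ≤ V_core`,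
  `|Q ∖ Q_core| ≤ V_sh` (inner region pointwise; outer region `y ∉ Q_in` by Tonelli `∫_{x∈Q}∫_{y∉Q_in} k_σ(x−y)`, split at `x ∈ Q_core`).

WHAT THIS IS NOT: Z-oseen itself (the Fubini/time assembly is the next file); 19708 / 20428 / ⟨27893⟩ OPEN; no claim about Navier–Stokes regularity.
-/

noncomputable section

-- the summit and its single sub-problem share the name (CONVENTIONS §1), as in every Theorems file
set_option linter.dupNamespace false

namespace Summit.NavierStokesRegularity.NavierStokesRegularity.Theorems.PoloidalWindowDoorPoloidalWindowRigidityZeroModeBoxKernel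

open MeasureTheory Set Function Filter Topology
open scoped RealInnerProductSpace ENNReal
open Literature.Analysis Literature.Analysis.FluidPDE Literature.Analysis.UnboundedOperators
open Summit.NavierStokesRegularity.NavierStokesRegularity.Theorems.PoloidalWindowDoorPoloidalWindowRigidityZeroModeRadial

/-! ## Translated integrals of the weight `k_σ(z) = (σ + ‖z‖²)^{-2}` -/

/-- The weight `z ↦ (σ + ‖z‖²)^{-2}` is measurable (as an `ℝ≥0∞`-valued function). [folklore] -/
theorem measurable_weight (σ : ℝ) :
    Measurable fun z : EuclideanSpace ℝ (Fin 3) => ENNReal.ofReal ((σ + ‖z‖ ^ 2) ^ (-(2 : ℝ))) :=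
  ENNReal.measurable_ofReal.comp ((measurable_const.add (measurable_norm.pow_const 2)).pow_const _)

/-- **Whole space, translated**: `∫_x k_σ(x − y) dx = M₀ σ^{-1/2}` for `σ > 0`. [folklore] -/
theorem lintegral_weight_sub_right_eq {σ : ℝ} (hσ : 0 < σ) (y : EuclideanSpace ℝ (Fin 3)) :
    ∫⁻ x : EuclideanSpace ℝ (Fin 3), ENNReal.ofReal ((σ + ‖x - y‖ ^ 2) ^ (-(2 : ℝ))) =
      ENNReal.ofReal (σ ^ (-(1 / 2 : ℝ)) * ∫ w : EuclideanSpace ℝ (Fin 3), (1 + ‖w‖ ^ 2) ^ (-(2 : ℝ))) := by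
  rw [lintegral_sub_right_eq_self (fun z : EuclideanSpace ℝ (Fin 3) => ENNReal.ofReal ((σ + ‖z‖ ^ 2) ^ (-(2 : ℝ)))) y]
  exact lintegral_weight_eq hσ

/-- **Tail, translated**: if every point of the measurable set `S` is at distance `≥ r` from `y`, then
`∫_{x∈S} k_σ(x − y) dx ≤ ∫_{‖z‖≥r} k_σ ≤ 4M₀/r` (`σ ≥ 0`, `r > 0`). [folklore] -/
theorem setLIntegral_weight_sub_right_le_tail {σ r : ℝ} (hσ : 0 ≤ σ) (hr : 0 < r)
    {S : Set (EuclideanSpace ℝ (Fin 3))} (hS : MeasurableSet S) {y : EuclideanSpace ℝ (Fin 3)}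
    (hfar : ∀ x ∈ S, r ≤ ‖x - y‖) :
    ∫⁻ x in S, ENNReal.ofReal ((σ + ‖x - y‖ ^ 2) ^ (-(2 : ℝ))) ≤
      ENNReal.ofReal (4 * (∫ w : EuclideanSpace ℝ (Fin 3), (1 + ‖w‖ ^ 2) ^ (-(2 : ℝ))) / r) := by
  set f : EuclideanSpace ℝ (Fin 3) → ℝ≥0∞ := fun z => ENNReal.ofReal ((σ + ‖z‖ ^ 2) ^ (-(2 : ℝ))) with hf
  set g : EuclideanSpace ℝ (Fin 3) → ℝ≥0∞ := {z : EuclideanSpace ℝ (Fin 3) | r ≤ ‖z‖}.indicator f with hg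
  have hTm : MeasurableSet {z : EuclideanSpace ℝ (Fin 3) | r ≤ ‖z‖} :=
    measurableSet_le measurable_const measurable_norm
  calc ∫⁻ x in S, ENNReal.ofReal ((σ + ‖x - y‖ ^ 2) ^ (-(2 : ℝ)))
      = ∫⁻ x in S, f (x - y) := rfl
    _ ≤ ∫⁻ x in S, g (x - y) := by
        refine setLIntegral_mono' hS fun x hx => ?_
        rw [hg, indicator_of_mem (show x - y ∈ {z : EuclideanSpace ℝ (Fin 3) | r ≤ ‖z‖} from hfar x hx)]
    _ ≤ ∫⁻ x, g (x - y) := setLIntegral_le_lintegral _ _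
    _ = ∫⁻ z, g z := lintegral_sub_right_eq_self g y
    _ = ∫⁻ z in {z : EuclideanSpace ℝ (Fin 3) | r ≤ ‖z‖}, f z := lintegral_indicator hTm f
    _ ≤ ENNReal.ofReal (4 * (∫ w : EuclideanSpace ℝ (Fin 3), (1 + ‖w‖ ^ 2) ^ (-(2 : ℝ))) / r) :=
        lintegral_weight_tail_le hσ hr

/-- **Tail, translated, other variable**: if every point of the measurable set `S` is at distance `≥ r` from `x`, then
`∫_{y∈S} k_σ(x − y) dy ≤ 4M₀/r`. [folklore] -/
theorem setLIntegral_weight_sub_left_le_tail {σ r : ℝ} (hσ : 0 ≤ σ) (hr : 0 < r)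
    {S : Set (EuclideanSpace ℝ (Fin 3))} (hS : MeasurableSet S) {x : EuclideanSpace ℝ (Fin 3)}
    (hfar : ∀ y ∈ S, r ≤ ‖x - y‖) :
    ∫⁻ y in S, ENNReal.ofReal ((σ + ‖x - y‖ ^ 2) ^ (-(2 : ℝ))) ≤
      ENNReal.ofReal (4 * (∫ w : EuclideanSpace ℝ (Fin 3), (1 + ‖w‖ ^ 2) ^ (-(2 : ℝ))) / r) := by
  have h := setLIntegral_weight_sub_right_le_tail (σ := σ) hσ hr hS (y := x) (fun y hy => by rw [norm_sub_rev]; exact hfar y hy)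
  refine le_trans (le_of_eq ?_) h
  refine lintegral_congr fun y => ?_
  rw [norm_sub_rev]

/-! ## The box integral of the kernel: direct bound and inner-region bound -/

/-- **Kernel → weight under a set integral**: `∫_{x∈S} ‖K(σ,x−y)[a,b]‖ ≤ C₀‖a‖‖b‖ ∫_{x∈S} k_σ(x−y)`. [folklore] -/
theorem setLIntegral_enorm_oseenKernel_sub_le {C₀ : ℝ} (hC₀ : 0 ≤ C₀)
    (hK : ∀ ⦃σ : ℝ⦄, 0 < σ → ∀ z a b : EuclideanSpace ℝ (Fin 3),
      ‖oseenKernel σ z a b‖ ≤ C₀ * (σ + ‖z‖ ^ 2) ^ (-(2 : ℝ)) * ‖a‖ * ‖b‖)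
    {σ : ℝ} (hσ : 0 < σ) (a b y : EuclideanSpace ℝ (Fin 3)) (S : Set (EuclideanSpace ℝ (Fin 3))) :
    ∫⁻ x in S, ‖oseenKernel σ (x - y) a b‖ₑ ≤
      ENNReal.ofReal (C₀ * ‖a‖ * ‖b‖) * ∫⁻ x in S, ENNReal.ofReal ((σ + ‖x - y‖ ^ 2) ^ (-(2 : ℝ))) := by
  rw [← lintegral_const_mul' _ _ ENNReal.ofReal_ne_top]
  refine lintegral_mono fun x => ?_
  rw [← ofReal_norm, ← ENNReal.ofReal_mul (by positivity)]
  refine ENNReal.ofReal_le_ofReal ?_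
  calc ‖oseenKernel σ (x - y) a b‖ ≤ C₀ * (σ + ‖x - y‖ ^ 2) ^ (-(2 : ℝ)) * ‖a‖ * ‖b‖ := hK hσ _ a b
    _ = C₀ * ‖a‖ * ‖b‖ * (σ + ‖x - y‖ ^ 2) ^ (-(2 : ℝ)) := by ring

/-- **Direct bound** of the box integral: `‖∫_{x∈Q} K(σ,x−y)[a,b]‖ ≤ C₀‖a‖‖b‖ ∫_{x∈Q} k_σ(x−y)`. [folklore] -/
theorem enorm_setIntegral_oseenKernel_le {C₀ : ℝ} (hC₀ : 0 ≤ C₀)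
    (hK : ∀ ⦃σ : ℝ⦄, 0 < σ → ∀ z a b : EuclideanSpace ℝ (Fin 3),
      ‖oseenKernel σ z a b‖ ≤ C₀ * (σ + ‖z‖ ^ 2) ^ (-(2 : ℝ)) * ‖a‖ * ‖b‖)
    {σ : ℝ} (hσ : 0 < σ) (a b y : EuclideanSpace ℝ (Fin 3)) (Q : Set (EuclideanSpace ℝ (Fin 3))) :
    ‖∫ x in Q, oseenKernel σ (x - y) a b‖ₑ ≤
      ENNReal.ofReal (C₀ * ‖a‖ * ‖b‖) * ∫⁻ x in Q, ENNReal.ofReal ((σ + ‖x - y‖ ^ 2) ^ (-(2 : ℝ))) :=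
  (enorm_integral_le_lintegral_enorm _).trans (setLIntegral_enorm_oseenKernel_sub_le hC₀ hK hσ a b y Q)

/-- **Inner region**: if every point of `Qᶜ` is at distance `≥ r` from `y` (`Q` measurable), then
`‖∫_{x∈Q} K(σ,x−y)[a,b] dx‖ ≤ C₀‖a‖‖b‖·4M₀/r`.  The whole-space integral of the kernel VANISHES (oddness,
`Literature.Analysis.FluidPDE.integral_oseenKernel_eq_zero`), so the box integral is minus the integral over `Qᶜ ⊆ {‖x−y‖ ≥ r}`. [folklore] -/
theorem enorm_setIntegral_oseenKernel_le_of_far {C₀ : ℝ} (hC₀ : 0 ≤ C₀)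
    (hK : ∀ ⦃σ : ℝ⦄, 0 < σ → ∀ z a b : EuclideanSpace ℝ (Fin 3),
      ‖oseenKernel σ z a b‖ ≤ C₀ * (σ + ‖z‖ ^ 2) ^ (-(2 : ℝ)) * ‖a‖ * ‖b‖)
    {σ r : ℝ} (hσ : 0 < σ) (hr : 0 < r) (a b y : EuclideanSpace ℝ (Fin 3)) {Q : Set (EuclideanSpace ℝ (Fin 3))}
    (hQ : MeasurableSet Q) (hfar : ∀ x ∈ Qᶜ, r ≤ ‖x - y‖) :
    ‖∫ x in Q, oseenKernel σ (x - y) a b‖ₑ ≤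
      ENNReal.ofReal (C₀ * ‖a‖ * ‖b‖ * (4 * (∫ w : EuclideanSpace ℝ (Fin 3), (1 + ‖w‖ ^ 2) ^ (-(2 : ℝ))) / r)) := by
  have hint : Integrable (fun x : EuclideanSpace ℝ (Fin 3) => oseenKernel σ (x - y) a b) := by
    obtain ⟨C, -, h⟩ := exists_lintegral_enorm_oseenKernel_le (E := EuclideanSpace ℝ (Fin 3))
    exact (h hσ a b).1.comp_sub_right y
  have hsplit := integral_add_compl hQ hint
  have hzero : ∫ x : EuclideanSpace ℝ (Fin 3), oseenKernel σ (x - y) a b = 0 := by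
    rw [integral_sub_right_eq_self (fun z : EuclideanSpace ℝ (Fin 3) => oseenKernel σ z a b) y]
    exact integral_oseenKernel_eq_zero σ a b
  have heq : ∫ x in Q, oseenKernel σ (x - y) a b = -∫ x in Qᶜ, oseenKernel σ (x - y) a b := by
    rw [hzero] at hsplit
    exact eq_neg_of_add_eq_zero_left hsplit
  have hM₀ : 0 ≤ 4 * (∫ w : EuclideanSpace ℝ (Fin 3), (1 + ‖w‖ ^ 2) ^ (-(2 : ℝ))) / r :=
    div_nonneg (mul_nonneg (by norm_num) integral_weight_one_pos.le) hr.le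
  rw [heq, enorm_neg]
  calc ‖∫ x in Qᶜ, oseenKernel σ (x - y) a b‖ₑ
      ≤ ENNReal.ofReal (C₀ * ‖a‖ * ‖b‖) * ∫⁻ x in Qᶜ, ENNReal.ofReal ((σ + ‖x - y‖ ^ 2) ^ (-(2 : ℝ))) :=
        enorm_setIntegral_oseenKernel_le hC₀ hK hσ a b y Qᶜ
    _ ≤ ENNReal.ofReal (C₀ * ‖a‖ * ‖b‖) *
          ENNReal.ofReal (4 * (∫ w : EuclideanSpace ℝ (Fin 3), (1 + ‖w‖ ^ 2) ^ (-(2 : ℝ))) / r) := by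
        gcongr
        exact setLIntegral_weight_sub_right_le_tail hσ.le hr hQ.compl hfar
    _ = _ := (ENNReal.ofReal_mul (by positivity)).symm


/-! ## The `L¹_y` size of the box integral: three regions -/

/-- **Three-region estimate.**  For `σ > 0`, `r > 0`, fields `a, b` bounded by `M`, a measurable box `Q` with a measurable «inner box» `Q_in`
(every point of `Qᶜ` at distance `≥ r` from every point of `Q_in`) and a measurable «core» `Q_core ⊆ Q` (every point of `Q_inᶜ` at distance `≥ r`
from every point of `Q_core`), and volume bounds `|Q_in| ≤ V_in`, `|Q_core| ≤ V_core`, `|Q ∖ Q_core| ≤ V_sh`: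
`∫_y ‖∫_{x∈Q} K(σ,x−y)[a(y),b(y)] dx‖ dy ≤ C₀ M² M₀ (4(V_in + V_core)/r + V_sh σ^{-1/2})`.
Inner region `y ∈ Q_in`: `enorm_setIntegral_oseenKernel_le_of_far` pointwise; outer region `y ∉ Q_in`: direct bound, Tonelli
`∫_{y∉Q_in}∫_{x∈Q} k_σ(x−y) = ∫_{x∈Q}∫_{y∉Q_in} k_σ(x−y)`, then `x ∈ Q_core` (tail `4M₀/r`) or `x ∈ Q ∖ Q_core` (mass `M₀σ^{-1/2}`). [folklore] -/
theorem lintegral_enorm_setIntegral_oseenKernel_le {C₀ : ℝ} (hC₀ : 0 ≤ C₀)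
    (hK : ∀ ⦃σ : ℝ⦄, 0 < σ → ∀ z a b : EuclideanSpace ℝ (Fin 3),
      ‖oseenKernel σ z a b‖ ≤ C₀ * (σ + ‖z‖ ^ 2) ^ (-(2 : ℝ)) * ‖a‖ * ‖b‖)
    {σ r M : ℝ} (hσ : 0 < σ) (hr : 0 < r) (hM : 0 ≤ M)
    {a b : EuclideanSpace ℝ (Fin 3) → EuclideanSpace ℝ (Fin 3)} (ha : ∀ y, ‖a y‖ ≤ M) (hb : ∀ y, ‖b y‖ ≤ M)
    {Q Qin Qcore : Set (EuclideanSpace ℝ (Fin 3))} (hQ : MeasurableSet Q) (hQin : MeasurableSet Qin)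
    (hQcore : MeasurableSet Qcore) (hcoreQ : Qcore ⊆ Q)
    (hin : ∀ y ∈ Qin, ∀ x ∈ Qᶜ, r ≤ ‖x - y‖) (hcore : ∀ x ∈ Qcore, ∀ y ∈ Qinᶜ, r ≤ ‖x - y‖)
    {Vin Vcore Vsh : ℝ} (h0in : 0 ≤ Vin) (h0core : 0 ≤ Vcore) (h0sh : 0 ≤ Vsh)
    (hVin : volume Qin ≤ ENNReal.ofReal Vin) (hVcore : volume Qcore ≤ ENNReal.ofReal Vcore)
    (hVsh : volume (Q \ Qcore) ≤ ENNReal.ofReal Vsh) :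
    ∫⁻ y, ‖∫ x in Q, oseenKernel σ (x - y) (a y) (b y)‖ₑ ≤
      ENNReal.ofReal (C₀ * M ^ 2 * (∫ w : EuclideanSpace ℝ (Fin 3), (1 + ‖w‖ ^ 2) ^ (-(2 : ℝ))) *
        (4 * (Vin + Vcore) / r + Vsh * σ ^ (-(1 / 2 : ℝ)))) := by
  set M₀ : ℝ := ∫ w : EuclideanSpace ℝ (Fin 3), (1 + ‖w‖ ^ 2) ^ (-(2 : ℝ)) with hM₀
  have hM₀pos : 0 < M₀ := integral_weight_one_pos
  have hσh : 0 ≤ σ ^ (-(1 / 2 : ℝ)) := Real.rpow_nonneg hσ.le _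
  set k : EuclideanSpace ℝ (Fin 3) → EuclideanSpace ℝ (Fin 3) → ℝ≥0∞ :=
    fun x y => ENNReal.ofReal ((σ + ‖x - y‖ ^ 2) ^ (-(2 : ℝ))) with hk
  set I : EuclideanSpace ℝ (Fin 3) → ℝ≥0∞ := fun y => ‖∫ x in Q, oseenKernel σ (x - y) (a y) (b y)‖ₑ with hI
  have hab : ∀ y, C₀ * ‖a y‖ * ‖b y‖ ≤ C₀ * M ^ 2 := fun y => by
    have h1 : ‖a y‖ * ‖b y‖ ≤ M * M := mul_le_mul (ha y) (hb y) (norm_nonneg _) hM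
    nlinarith [h1]
  -- (i) the inner region, pointwise
  have h1 : ∫⁻ y in Qin, I y ≤ ENNReal.ofReal (Vin * (C₀ * M ^ 2 * (4 * M₀ / r))) := by
    calc ∫⁻ y in Qin, I y ≤ ∫⁻ y in Qin, ENNReal.ofReal (C₀ * M ^ 2 * (4 * M₀ / r)) := by
          refine setLIntegral_mono' hQin fun y hy => ?_
          refine (enorm_setIntegral_oseenKernel_le_of_far hC₀ hK hσ hr (a y) (b y) y hQ (hin y hy)).trans ?_
          exact ENNReal.ofReal_le_ofReal (mul_le_mul_of_nonneg_right (hab y) (by positivity))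
      _ = ENNReal.ofReal (C₀ * M ^ 2 * (4 * M₀ / r)) * volume Qin := setLIntegral_const _ _
      _ ≤ ENNReal.ofReal (C₀ * M ^ 2 * (4 * M₀ / r)) * ENNReal.ofReal Vin := by gcongr
      _ = ENNReal.ofReal (Vin * (C₀ * M ^ 2 * (4 * M₀ / r))) := by
          rw [← ENNReal.ofReal_mul (by positivity), mul_comm]
  -- (ii) the outer region: direct bound, then Tonelli
  have h2a : ∫⁻ y in Qinᶜ, I y ≤ ENNReal.ofReal (C₀ * M ^ 2) * ∫⁻ y in Qinᶜ, ∫⁻ x in Q, k x y := by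
    calc ∫⁻ y in Qinᶜ, I y ≤ ∫⁻ y in Qinᶜ, ENNReal.ofReal (C₀ * M ^ 2) * ∫⁻ x in Q, k x y := by
          refine setLIntegral_mono' hQin.compl fun y _ => ?_
          refine (enorm_setIntegral_oseenKernel_le hC₀ hK hσ (a y) (b y) y Q).trans ?_
          exact mul_le_mul_of_nonneg_right (ENNReal.ofReal_le_ofReal (hab y)) bot_le
      _ = ENNReal.ofReal (C₀ * M ^ 2) * ∫⁻ y in Qinᶜ, ∫⁻ x in Q, k x y :=
          lintegral_const_mul' _ _ ENNReal.ofReal_ne_top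
  have hswap : ∫⁻ y in Qinᶜ, ∫⁻ x in Q, k x y = ∫⁻ x in Q, ∫⁻ y in Qinᶜ, k x y := by
    refine lintegral_lintegral_swap ?_
    have hm : Measurable fun p : EuclideanSpace ℝ (Fin 3) × EuclideanSpace ℝ (Fin 3) =>
        ENNReal.ofReal ((σ + ‖p.2 - p.1‖ ^ 2) ^ (-(2 : ℝ))) :=
      (measurable_weight σ).comp (measurable_snd.sub measurable_fst)
    exact hm.aemeasurable
  have h2core : ∫⁻ x in Qcore, ∫⁻ y in Qinᶜ, k x y ≤ ENNReal.ofReal (4 * M₀ / r * Vcore) := by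
    calc ∫⁻ x in Qcore, ∫⁻ y in Qinᶜ, k x y ≤ ∫⁻ x in Qcore, ENNReal.ofReal (4 * M₀ / r) :=
          setLIntegral_mono' hQcore fun x hx => setLIntegral_weight_sub_left_le_tail hσ.le hr hQin.compl (hcore x hx)
      _ = ENNReal.ofReal (4 * M₀ / r) * volume Qcore := setLIntegral_const _ _
      _ ≤ ENNReal.ofReal (4 * M₀ / r) * ENNReal.ofReal Vcore := by gcongr
      _ = ENNReal.ofReal (4 * M₀ / r * Vcore) := by rw [← ENNReal.ofReal_mul (by positivity)]
  have h2sh : ∫⁻ x in Q \ Qcore, ∫⁻ y in Qinᶜ, k x y ≤ ENNReal.ofReal (M₀ * σ ^ (-(1 / 2 : ℝ)) * Vsh) := by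
    calc ∫⁻ x in Q \ Qcore, ∫⁻ y in Qinᶜ, k x y ≤ ∫⁻ x in Q \ Qcore, ENNReal.ofReal (M₀ * σ ^ (-(1 / 2 : ℝ))) := by
          refine setLIntegral_mono' (hQ.diff hQcore) fun x _ => ?_
          calc ∫⁻ y in Qinᶜ, k x y ≤ ∫⁻ y, k x y := setLIntegral_le_lintegral _ _
            _ = ENNReal.ofReal (M₀ * σ ^ (-(1 / 2 : ℝ))) := by
                rw [hk]
                dsimp only
                rw [lintegral_weight_sub_left σ 2 x, lintegral_weight_eq hσ, mul_comm]
      _ = ENNReal.ofReal (M₀ * σ ^ (-(1 / 2 : ℝ))) * volume (Q \ Qcore) := setLIntegral_const _ _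
      _ ≤ ENNReal.ofReal (M₀ * σ ^ (-(1 / 2 : ℝ))) * ENNReal.ofReal Vsh := by gcongr
      _ = ENNReal.ofReal (M₀ * σ ^ (-(1 / 2 : ℝ)) * Vsh) := by rw [← ENNReal.ofReal_mul (by positivity)]
  have h2 : ∫⁻ y in Qinᶜ, I y ≤
      ENNReal.ofReal (C₀ * M ^ 2 * (4 * M₀ / r * Vcore) + C₀ * M ^ 2 * (M₀ * σ ^ (-(1 / 2 : ℝ)) * Vsh)) := by
    have hsplitx : ∫⁻ x in Q, ∫⁻ y in Qinᶜ, k x y =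
        (∫⁻ x in Qcore, ∫⁻ y in Qinᶜ, k x y) + ∫⁻ x in Q \ Qcore, ∫⁻ y in Qinᶜ, k x y := by
      have h := lintegral_inter_add_sdiff (μ := volume) (fun x => ∫⁻ y in Qinᶜ, k x y) Q hQcore
      rw [inter_eq_right.2 hcoreQ] at h
      exact h.symm
    calc ∫⁻ y in Qinᶜ, I y ≤ ENNReal.ofReal (C₀ * M ^ 2) * ∫⁻ y in Qinᶜ, ∫⁻ x in Q, k x y := h2a
      _ = ENNReal.ofReal (C₀ * M ^ 2) *
            ((∫⁻ x in Qcore, ∫⁻ y in Qinᶜ, k x y) + ∫⁻ x in Q \ Qcore, ∫⁻ y in Qinᶜ, k x y) := by rw [hswap, hsplitx]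
      _ ≤ ENNReal.ofReal (C₀ * M ^ 2) *
            (ENNReal.ofReal (4 * M₀ / r * Vcore) + ENNReal.ofReal (M₀ * σ ^ (-(1 / 2 : ℝ)) * Vsh)) :=
          mul_le_mul_of_nonneg_left (add_le_add h2core h2sh) bot_le
      _ = _ := by
          rw [← ENNReal.ofReal_add (by positivity) (by positivity), ← ENNReal.ofReal_mul (by positivity), mul_add]
  -- (iii) sum
  calc ∫⁻ y, I y = (∫⁻ y in Qin, I y) + ∫⁻ y in Qinᶜ, I y := (lintegral_add_compl I hQin).symm
    _ ≤ ENNReal.ofReal (Vin * (C₀ * M ^ 2 * (4 * M₀ / r))) +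
          ENNReal.ofReal (C₀ * M ^ 2 * (4 * M₀ / r * Vcore) + C₀ * M ^ 2 * (M₀ * σ ^ (-(1 / 2 : ℝ)) * Vsh)) :=
        add_le_add h1 h2
    _ = ENNReal.ofReal (C₀ * M ^ 2 * M₀ * (4 * (Vin + Vcore) / r + Vsh * σ ^ (-(1 / 2 : ℝ)))) := by
        rw [← ENNReal.ofReal_add (by positivity) (by positivity)]
        congr 1
        field_simp
        ring

end Summit.NavierStokesRegularity.NavierStokesRegularity.Theorems.PoloidalWindowDoorPoloidalWindowRigidityZeroModeBoxKernel

end
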